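import Summits.QuantumFields.YangMills.Theorems.LuscherReductionTwistedTraceScalingBaseOfWindow
import HarnessLib

/-!
# Registered stub `stub_coarseNoIntruderAt2 : Stmt.stub_coarseNoIntruderAt2` (3b′, BOTTOM-upper at `L₀ = 2`) of skeleton «KTR» rev 8
# (crux RED `RunningReduction`, stmt-QuantumFields-19978) — BY NAME AND SIGNATURE, unconditional

Route `LuscherReduction` (rung R2b1), crux RED `RunningReduction` (stmt-QuantumFields-19978), registered skeleton «KTR» rev 8
(`pub/ym-beyond/p1-g19-files/Lines-KTR-r8.lean`, sha16 4d4e029b06d8e70b, `ledger skeleton check` 2026-08-27T07:22:32Z), KT door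
PART 2 §2: the stub `stub_coarseNoIntruderAt2 : Stmt.stub_coarseNoIntruderAt2` with
`abbrev Stmt.stub_coarseNoIntruderAt2 : Prop := KTCoarseHandover.CoarseNoIntruderAt 2`, `CoarseNoIntruderAt L0` the skeleton's PART 1
text (card `handover-split` rev 3): Lüscher's law FROM BELOW with relative error `o(1)` on the SINGLE lattice size `L₀` — for every
`d < Δ_k`, once `lam` is small, every `β` in the femto window AT `L₀` has `λ_k(L₀,β) ≤ e^{−dΛ(β,L₀)/L₀}·λ_0(L₀,β)` (finite-dimensional
semiclassics, `β → ∞`, of the zero-flux transfer operator on the fixed compact manifold `SU(2)^{3L₀³}`; no one-site model, no `L → ∞`).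

WHY IT IS CLOSED: the S-BASE lane of the sibling crux `TwistedTraceScaling` (stmt-QuantumFields-20203, line «twolattice», leads
ym-luscher-20007-p1 g23/g24) proved COARSE-UPPER(L) for EVERY fixed `L ≥ 2` as a tree theorem —
`TwoLattice.ConstTube.coarseUpper (hL2 : 2 ≤ L)` (`Theorems/LuscherReductionTwistedTraceScalingCoarseUpperOfHOD.lean`: the eight thin
shells of `coarseUpper_of_thinShells` discharged by `innerShellGainSmallAt_record_low` fed with `hOD_record_low`), whose conclusion is,
character for character, the body of KTR's `CoarseNoIntruderAt L` («`L = 2` is stub 3b′», as every one of those modules says).  Nobody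
had re-keyed the instance `L = 2` to RED's registered stub; this module does exactly that and nothing else.

The gate credits a stub landing only for the VERBATIM header `theorem stub_coarseNoIntruderAt2 : Stmt.stub_coarseNoIntruderAt2 := …`
(docs/reference/gate.md A8), and the skeleton (a pub file) is not importable from `Theorems/`.  This module therefore re-homes
`CoarseNoIntruderAt` (PART 1 text, CHARACTER FOR CHARACTER, a predicate of the lattice size) and the statement abbreviation
`Stmt.stub_coarseNoIntruderAt2 := CoarseNoIntruderAt 2` under the Theorems-side namespace `…Theorems.FemtoTransferGap.KTCoarseHandover`
(it cannot collide with the skeleton's `…Cruxes.RunningReduction.KTCoarseHandover.*` / `…KT.Stmt.*`; the texts are syntactically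
identical under the same `open`s, hence interchangeable by `Iff.rfl`) and proves it with no hypothesis:

  `stub_coarseNoIntruderAt2 := coarseNoIntruderAt_all 2`, `coarseNoIntruderAt_all := TwoLattice.Base.coarseUpper_all` (every `L0`; `L0 ≥ 2` is `ConstTube.coarseUpper`)

Owner's discharge in the skeleton: `theorem stub_coarseNoIntruderAt2 : Stmt.stub_coarseNoIntruderAt2 :=
Summit.QuantumFields.YangMills.Theorems.FemtoTransferGap.KTCoarseHandover.stub_coarseNoIntruderAt2`.  With 3b′ closed, KT's derived
stub 3 `CoarseNoIntruder` (`KTCoarseHandover.coarseNoIntruder_of_handover_two`, matching `matchedCoupling 2` proved in the skeleton)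
hinges on 3a′ `stub_coarseHandoverUpper2` ALONE (UV′-upper: one-sided cutoff universality of the femto spectrum at matched two-loop
label, fine `L` versus coarse `2` — the RG statement; OPEN).

`CoarseNoIntruderAt` is a predicate (parameter `L0`) and `Stmt.stub_coarseNoIntruderAt2` a statement abbreviation WITH a
kernel-closed witness in this very module (audit class `proved-helper`); neither is a named fact and nothing under `Theorems/` takes
them as hypotheses.

HONEST FRAMING: fixed lattice size `L₀ = 2` (24 links), eventually in `β` (astronomical thresholds), on the femto rung R2b1 of the
CONDITIONAL Lüscher reduction route; closes ONE of seven registered stubs of RED's skeleton by name; proves nothing of the RG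
statements (`CoarseHandoverUpper 2`, `ExplicitNoIntruder`, `TwistedTraceScaling`, `DressedRitz`), nothing about infinite volume, the
continuum limit, a mass gap or Clay.  Sorry-free, no named-fact hypotheses.
-/

set_option autoImplicit false

noncomputable section

namespace Summit.QuantumFields.YangMills.Theorems.FemtoTransferGap.KTCoarseHandover

open Summit.QuantumFields.YangMills.Theorems.FemtoTransferGap

/-- **BOTTOM-upper = `CoarseNoIntruderAt L0`** — VERBATIM the PART 1 text of skeleton «KTR» rev 8 (sha16 4d4e029b06d8e70b; namespace
`…Cruxes.RunningReduction.KTCoarseHandover`; card `handover-split` rev 3, stub 3b′ is `L0 = 2`), over the tree objects `levelGap`,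
`InFemtoWindow`, `levelValue`, `su2Rep`, `luscherLambda`: Lüscher's law from below with relative error `o(1)` on the SINGLE lattice size
`L0` — for every `d < Δ_k`, once `lam` is small, every `β` in the femto window AT `L0` has `λ_k(L0,β) ≤ e^{−dλ(β,L0)/L0} λ_0(L0,β)`.  No
one-site model, no `ONE`, no limit `L → ∞`: semiclassics (`β → ∞`) of the zero-flux transfer operator on the fixed compact manifold
`SU(2)^{3L0³}`.  A predicate of `L0` (not a named fact); deliberately WITHOUT a citation tag (re-homed skeleton text over Summits-side
objects; the proof below carries the citations). -/
def CoarseNoIntruderAt (L0 : ℕ) [NeZero L0] : Prop :=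
  ∀ k : ℕ, ∀ d : ℝ, d < levelGap k → ∃ lam0 : ℝ, 0 < lam0 ∧ ∀ lam : ℝ, 0 < lam → lam ≤ lam0 →
    ∀ β : ℝ, InFemtoWindow lam β L0 →
      levelValue su2Rep L0 β k ≤ Real.exp (-(d * luscherLambda β L0) / L0) * levelValue su2Rep L0 β 0

/-- **`CoarseNoIntruderAt L0` holds at EVERY lattice size** (the kernel-closed witness of the re-homed predicate): `L0 = 1` from crux ONE
through the trivial Born–Oppenheimer handover `BO(1)` (`TwoLattice.coarseUpper_one`), `L0 ≥ 2` the tree theorem COARSE-UPPER(L0)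
`TwoLattice.ConstTube.coarseUpper` — packaged as `TwoLattice.Base.coarseUpper_all` (`Theorems/LuscherReductionTwistedTraceScalingBaseOfWindow.lean`).
[cite: Luscher1983, §3] [cite: LuscherMunster1984, §2] -/
theorem coarseNoIntruderAt_all (L0 : ℕ) [NeZero L0] : CoarseNoIntruderAt L0 :=
  TwoLattice.Base.coarseUpper_all L0

/-- Stub statement (3b′, L, finite-dimensional) — VERBATIM `KT.Stmt.stub_coarseNoIntruderAt2 := KTCoarseHandover.CoarseNoIntruderAt 2` of
skeleton «KTR» rev 8 (sha16 4d4e029b06d8e70b): Lüscher's law from below with relative error `o(1)` on the single lattice size `L0 = 2`.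
Deliberately WITHOUT a citation tag. -/
abbrev Stmt.stub_coarseNoIntruderAt2 : Prop := CoarseNoIntruderAt 2

/-- ★ **Registered stub `stub_coarseNoIntruderAt2` (3b′) of skeleton «KTR» rev 8 (crux RED, stmt-QuantumFields-19978), BY NAME,
unconditional**: on the fixed lattice `L₀ = 2`, for every level `k` and every `d < Δ_k`, deep in the femto window
`λ_k(2,β) ≤ e^{−dΛ(β,2)/2}·λ_0(2,β)` — the instance `L = 2` of the tree theorem COARSE-UPPER(L) `TwoLattice.ConstTube.coarseUpper`
(S-BASE lane of crux `TwistedTraceScaling`, stmt-QuantumFields-20203). [cite: Luscher1983, §3] [cite: LuscherMunster1984, §2] -/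
theorem stub_coarseNoIntruderAt2 : Stmt.stub_coarseNoIntruderAt2 :=
  coarseNoIntruderAt_all 2

end Summit.QuantumFields.YangMills.Theorems.FemtoTransferGap.KTCoarseHandover

end
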